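import Summits.CriticalPhenomena.PercolationContinuityZ3.Theorems.PercNearOneGluingNoHeavyLowerTailKnQuestion8CoefficientwiseCoreClassKernelMixHubMu1
import Summits.CriticalPhenomena.PercolationContinuityZ3.Theorems.PercNearOneGluingNoHeavyLowerTailKnQuestion8CoefficientwiseCoreClassKernelMixHubMu2
import HarnessLib

/-!
# The augmented staircase theorem: an explicit perfect matching along double toggles (PATH LEMMA of hub-Kleitman, layer 4)

Support file (`--supports stmt-CriticalPhenomena-4575`, closed), prover `prim-cplus-coupling` (gen 51).  No definitions, no notations,
no named facts, no sorries; standard axioms.  Memo `prim-cplus-coupling/A5-COUPLING-gen51.md` §2 (Theorem 1).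

THE THEOREM (`hubStair_matching`).  Data as in `…KernelMixHubMu1` / `…HubMu2` (hypothesis style): the staircase (`xi` rows /
`om` columns), the down-closed cell set `A` (rows `alpha`, columns `alphaP`, diagonal/domino extents `sA`, `dA`), the up-closed
cell set `B` (`beta`, `betaP`, `bd`, `db`), the family `𝒱` (`hV`) and the two toggles `t₁`, `t₂`.  Let `𝔉 = {E ∈ 𝒱 : |E| even}`
(in the path lemma: BB sources / RR targets = inner even sets, RB sources / BR targets = `{0} ∪ D`, BR sources / RB targets
= `D ∪ {N}`, all-blue / all-red = `∅`).  Then `σ E := (E ∆ {t₁ E}) ∆ {t₂ (E ∆ {t₁ E})}` maps `𝔉` into `𝔉`, is injective on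
`𝔉`, and `σ E = E ∆ {a} ∆ {b}` with `a < b`, `a ≤ e ≤ b` for all `e ∈ E ∪ σ E` (a two-sided hub move), or `E = σ E = ∅`
(all-blue ↦ all-red).  This is the perfect matching 'sources → targets along hub moves' of the memo's Corollary 2.6, i.e.
the PATH LEMMA `#(F ∩ W) ≤ #(F ∩ cW)` for all four gate types after the reductions of memo §1.
Proof: `…HubMu1` (μ₁ involution of 𝒱), `…HubMu2` (μ₂ involution of 𝒱), parity flips, and the factorisation lemma (memo 2.1).
[cite: KozmaNitzan2024, Questions 8–9 (§5.5 p. 36) (context)]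
-/

namespace Summit.CriticalPhenomena.PercolationContinuityZ3.Theorems

open Finset
open scoped symmDiff

namespace Coefficientwise

/-- **Augmented staircase theorem** (memo gen51 Theorem 1): the composite of the two threshold toggles is an injective
self-map of the even family `𝔉` along two-sided hub moves.  See the module docstring for the dictionary with the path
lemma. [folklore] -/
theorem hubStair_matching (N : ℕ) (hN : 2 ≤ N)
    (xi om alpha alphaP beta betaP : ℕ → ℕ) (sA dA bd db : ℕ) (A B : Finset (ℕ × ℕ))
    (hxi : ∀ y, 1 ≤ y → y ≤ N - 1 → 1 ≤ xi y ∧ xi y ≤ y)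
    (hxi2 : ∀ y, 2 ≤ y → y ≤ N - 1 → xi y ≤ y - 1)
    (hRrc : ∀ x y, 1 ≤ x → x ≤ y → y ≤ N - 1 → (xi y ≤ x ↔ y ≤ om x))
    (hom : ∀ x, 1 ≤ x → x ≤ N - 1 → x + 1 ≤ om x ∧ om x ≤ N)
    (hArow : ∀ x y, (x, y) ∈ A ↔ 1 ≤ x ∧ x ≤ y ∧ y ≤ N - 1 ∧ x ≤ alpha y)
    (hAcol : ∀ x y, (x, y) ∈ A ↔ 1 ≤ x ∧ x ≤ y ∧ y ≤ N - 1 ∧ y ≤ alphaP x)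
    (hAR : ∀ x y, (x, y) ∈ A → xi y ≤ x)
    (hAdiag : ∀ x, (x, x) ∈ A ↔ 1 ≤ x ∧ x ≤ sA)
    (hAdom : ∀ x, (x, x + 1) ∈ A ↔ 1 ≤ x ∧ x ≤ dA)
    (hsd : dA ≤ sA ∧ sA ≤ dA + 1) (hsN : sA ≤ N - 1) (hdN : dA + 1 ≤ N - 1)
    (halphaP : ∀ x, alphaP x ≤ N - 1)
    (hBrow : ∀ x y, (x, y) ∈ B ↔ 1 ≤ x ∧ x ≤ y ∧ y ≤ N - 1 ∧ beta y ≤ x)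
    (hBcol : ∀ x y, (x, y) ∈ B ↔ 1 ≤ x ∧ x ≤ y ∧ y ≤ N - 1 ∧ betaP x ≤ y)
    (hBR : ∀ x y, (x, y) ∈ B → xi y ≤ x)
    (hBdiag : ∀ x, (x, x) ∈ B ↔ 1 ≤ x ∧ bd ≤ x ∧ x ≤ N - 1)
    (hBdom : ∀ x, (x, x + 1) ∈ B ↔ 1 ≤ x ∧ db ≤ x ∧ x + 1 ≤ N - 1)
    (hbd : db ≤ bd ∧ bd ≤ db + 1) (hbd1 : 1 ≤ db) (hdbN : db ≤ N - 1) (hbdN : bd ≤ N)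
    (hbeta1 : ∀ y, 1 ≤ beta y)
    (hbetaP : ∀ x, 1 ≤ x → x ≤ N - 1 → x ≤ betaP x ∧ betaP x ≤ N)
    (V : Finset ℕ → Prop)
    (hV : ∀ X, V X ↔
      (X = ∅ ∨
      (X.Nonempty ∧ 0 ∉ X ∧ N ∉ X ∧ (∀ e ∈ X, e ≤ N - 1) ∧ ∀ h : X.Nonempty, xi (X.max' h) ≤ X.min' h) ∨
      (0 ∈ X ∧ N ∉ X ∧ (∀ e ∈ X, e ≤ N - 1) ∧
        ((X = {0} ∧ sA = dA + 1) ∨ ∃ h : (X.erase 0).Nonempty, ((X.erase 0).min' h, (X.erase 0).max' h) ∈ A)) ∨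
      (N ∈ X ∧ 0 ∉ X ∧ (∀ e ∈ X, e ≤ N) ∧
        ((X = {N} ∧ bd = db) ∨ ∃ h : (X.erase N).Nonempty, ((X.erase N).min' h, (X.erase N).max' h) ∈ B))))
    (t₁ : Finset ℕ → ℕ)
    (ht₁ : ∀ X, t₁ X =
      if 0 ∈ X then 0
      else if N ∈ X then (if h : (X.erase N).Nonempty then beta ((X.erase N).max' h) else bd)
      else if h : X.Nonempty then
        (if (X.min' h, X.max' h) ∈ A then 0 else max (xi (X.max' h)) (alpha (X.max' h) + 1))
      else (if sA = dA + 1 then 0 else dA + 1))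
    (t₂ : Finset ℕ → ℕ)
    (ht₂ : ∀ X, t₂ X =
      if N ∈ X then N
      else if 0 ∈ X then (if h : (X.erase 0).Nonempty then alphaP ((X.erase 0).min' h) else sA)
      else if h : X.Nonempty then
        (if (X.min' h, X.max' h) ∈ B then N else min (om (X.min' h)) (betaP (X.min' h) - 1))
      else (if bd = db then N else db)) :
    ∃ σ : Finset ℕ → Finset ℕ,
      (∀ E, V E → Even E.card → V (σ E) ∧ Even (σ E).card) ∧
      (∀ E E', V E → Even E.card → V E' → Even E'.card → σ E = σ E' → E = E') ∧
      (∀ E, V E → Even E.card →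
        (E = ∅ ∧ σ E = ∅) ∨
        ∃ a b : ℕ, a < b ∧ σ E = E ∆ {a} ∆ {b} ∧ (∀ e ∈ E, a ≤ e ∧ e ≤ b) ∧ (∀ e ∈ σ E, a ≤ e ∧ e ≤ b)) := by
  classical
  have M1 := hubStair_mu1_invol N hN xi alpha beta sA dA bd db A B hxi hxi2 hArow hAR hAdiag hAdom hsd hdN hBrow
    hBdiag hBdom hbd hbd1 hdbN hbeta1 V hV t₁ ht₁
  have M2 := hubStair_mu2_invol N hN xi om alphaP betaP sA dA bd db A B hRrc hom hAcol hAdiag hAdom hsd hsN halphaP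
    hBcol hBdiag hBdom hbd hbd1 hdbN hbdN hbetaP hBR V hV t₂ ht₂
  refine ⟨fun E => (E ∆ {t₁ E}) ∆ {t₂ (E ∆ {t₁ E})}, ?_, ?_, ?_⟩
  · ------------------------------------------------------------------ into 𝔉
    intro E hE hEven
    obtain ⟨hO, _, _⟩ := M1 E hE
    obtain ⟨hS, _, _⟩ := M2 _ hO
    refine ⟨hS, ?_⟩
    rw [card_symmDiff_singleton_even_iff, card_symmDiff_singleton_even_iff]
    exact not_not.mpr hEven
  · ------------------------------------------------------------------ injective
    intro E E' hE _ hE' _ hEq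
    obtain ⟨hO, h1O, _⟩ := M1 E hE
    obtain ⟨hO', h1O', _⟩ := M1 E' hE'
    obtain ⟨_, h2S, _⟩ := M2 _ hO
    obtain ⟨_, h2S', _⟩ := M2 _ hO'
    -- the outer toggles agree
    have hb : t₂ (E ∆ {t₁ E}) = t₂ (E' ∆ {t₁ E'}) := by
      have e1 := h2S
      have e2 := h2S'
      simp only at hEq
      rw [hEq] at e1
      exact e1.symm.trans e2
    have hOO : E ∆ {t₁ E} = E' ∆ {t₁ E'} := by
      have e1 : (E ∆ {t₁ E}) ∆ {t₂ (E ∆ {t₁ E})} ∆ {t₂ (E ∆ {t₁ E})} = E ∆ {t₁ E} :=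
        symmDiff_symmDiff_cancel_right _ _
      have e2 : (E' ∆ {t₁ E'}) ∆ {t₂ (E' ∆ {t₁ E'})} ∆ {t₂ (E' ∆ {t₁ E'})} = E' ∆ {t₁ E'} :=
        symmDiff_symmDiff_cancel_right _ _
      rw [← e1, ← e2]
      simp only at hEq
      rw [hEq, hb]
    have ha : t₁ E = t₁ E' := by rw [← h1O, ← h1O', hOO]
    calc E = E ∆ {t₁ E} ∆ {t₁ E} := (symmDiff_symmDiff_cancel_right _ _).symm
      _ = E' ∆ {t₁ E'} ∆ {t₁ E'} := by rw [hOO, ha]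
      _ = E' := symmDiff_symmDiff_cancel_right _ _
  · ------------------------------------------------------------------ hub moves
    intro E hE hEven
    obtain ⟨hO, _, hale⟩ := M1 E hE
    obtain ⟨_, _, hble⟩ := M2 _ hO
    set a := t₁ E with hadef
    set b := t₂ (E ∆ {a}) with hbdef
    by_cases hE0 : E = ∅
    · -- E = ∅: O = {a}, σ ∅ = {a} ∆ {b}
      have hO1 : (∅ : Finset ℕ) ∆ {a} = {a} := by simp
      have hab : a ≤ b := by
        apply hble a
        rw [hE0, hO1]; exact mem_singleton_self a
      by_cases heq : a = b
      · left
        refine ⟨hE0, ?_⟩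
        show (E ∆ {a}) ∆ {b} = ∅
        rw [hE0, hO1, ← heq]; simp
      · right
        refine ⟨a, b, lt_of_le_of_ne hab heq, rfl, fun e he => absurd he (hE0 ▸ notMem_empty e), ?_⟩
        intro e he
        change e ∈ (E ∆ {a}) ∆ {b} at he
        rw [hE0, hO1, mem_symmDiff, mem_singleton, mem_singleton] at he
        rcases he with ⟨rfl, _⟩ | ⟨rfl, _⟩
        · exact ⟨le_rfl, hab⟩
        · exact ⟨hab, le_rfl⟩
    · right
      -- |E| ≥ 2: pick e₁ ∈ E with e₁ ≠ a
      have hne : E.Nonempty := nonempty_iff_ne_empty.mpr hE0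
      have hcard2 : 2 ≤ E.card := by
        have h0 : E.card ≠ 0 := card_ne_zero.mpr hne
        have h1 : E.card ≠ 1 := fun h => by rw [h] at hEven; exact Nat.not_even_one hEven
        omega
      obtain ⟨e₁, he₁E, he₁a⟩ : ∃ e₁ ∈ E, e₁ ≠ a := by
        by_contra hno
        push Not at hno
        have hsub : E ⊆ {a} := fun e he => mem_singleton.mpr (hno e he)
        have := card_le_card hsub
        rw [card_singleton] at this
        omega
      have he₁O : e₁ ∈ E ∆ {a} := by
        rw [mem_symmDiff, mem_singleton]; exact Or.inl ⟨he₁E, he₁a⟩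
      have hab : a < b := lt_of_lt_of_le (lt_of_le_of_ne (hale e₁ he₁E) (Ne.symm he₁a)) (hble e₁ he₁O)
      refine ⟨a, b, hab, rfl, fun e he => ⟨hale e he, ?_⟩, fun e he => ?_⟩
      · by_cases hea : e = a
        · rw [hea]; exact le_of_lt hab
        · apply hble; rw [mem_symmDiff, mem_singleton]; exact Or.inl ⟨he, hea⟩
      · change e ∈ (E ∆ {a}) ∆ {b} at he
        rw [mem_symmDiff, mem_singleton] at he
        rcases he with ⟨heO, _⟩ | ⟨rfl, _⟩
        · refine ⟨?_, hble e heO⟩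
          rw [mem_symmDiff, mem_singleton] at heO
          rcases heO with ⟨heE, _⟩ | ⟨rfl, _⟩
          · exact hale e heE
          · exact le_rfl
        · exact ⟨le_of_lt hab, le_rfl⟩

end Coefficientwise

end Summit.CriticalPhenomena.PercolationContinuityZ3.Theorems
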